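import Summits.Ventures.PercRepro.S1EightSixFourSevenTwice

/-!
# PercRepro — THE SHAPE `(rank 4 on 6) ⊕ (rank 4 on 8)` OF THE `(8, 6)` CELL (p2, gen 28; SUBCLAIM-S1 §6.10
(xvii)(p); PARTIAL — towards the `(8, 6)` capstone)

`M` coloop-free of rank `4` on `6` points (corank `2`), `N` coloop-free of rank `4` on `8` points (corank `4`), all
pairs of rank `2`. With `s₄'` the spanning `4`-sets of `M` and `t, q₂, q₃, s₄, s₅, s₆` the usual counts of `N`:
`#U ≤ s₄ + 6 (s₅ + q₃) + s₄' (s₆ + t + q₂)` (`N_M(4, 2) ≤ s₄'`: a spanning `4`-set with a pair as complement),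
`#Y ≥ 57 · 247 − f_M(2) f_N(2) − f_M(4) f_N(4) + 6 f_N(4) + 8 f_M(4)` with `f_M(2) ≤ 30`, `f_M(4) ≤ 7 + s₄'`,
`f_N(2) ≤ 72`, `f_N(4) ≤ 9 + s₆ + s₅ + s₄`; `Φ(8, 4) · #U ≤ #Y` (nlinarith). Nothing is claimed about any cell.

* `ncard_rankSet_four_le_rank_four_six`, `ncard_rankSet_two_le_rank_four_eight`, `ncard_rankSet_four_le_rank_four_eight`,
  `four_sets_le_seventy_rank_four_eight`; `y_products_general`;
* `c025_eight_four_disjointSum_four_six_four_eight`.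
Axioms: standard.
-/

open scoped Matroid

namespace PercRepro

namespace S1

open Set

variable {α : Type}

/-- `f(4) ≤ 7 + s₄` on `6` points of rank `4`: a spanning set is `E`, a `5`-set or a spanning `4`-set. -/
theorem ncard_rankSet_four_le_rank_four_six {N : Matroid α} [N.Finite] (hE : N.E.ncard = 6) :
    (rankSet N 4).ncard ≤ 7 + {Q : Set α | Q ⊆ N.E ∧ Q.ncard = 4 ∧ N.eRk Q = ((4 : ℕ) : ℕ∞)}.ncard := by
  have hf : ∀ k : ℕ, {A : Set α | A ⊆ N.E ∧ A.ncard = k}.Finite := fun k =>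
    N.ground_finite.finite_subsets.subset (fun _ hA => hA.1)
  have hS4 : {Q : Set α | Q ⊆ N.E ∧ Q.ncard = 4 ∧ N.eRk Q = ((4 : ℕ) : ℕ∞)}.Finite :=
    (hf 4).subset (fun _ hA => ⟨hA.1, hA.2.1⟩)
  have hsub : rankSet N 4 ⊆ {A : Set α | A ⊆ N.E ∧ A.ncard = 6} ∪ {A : Set α | A ⊆ N.E ∧ A.ncard = 5} ∪
      {Q : Set α | Q ⊆ N.E ∧ Q.ncard = 4 ∧ N.eRk Q = ((4 : ℕ) : ℕ∞)} := by
    rintro A ⟨hAE, hA4⟩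
    have hAfin : A.Finite := N.ground_finite.subset hAE
    have hlo : 4 ≤ A.ncard := by
      have := N.eRk_le_encard A
      rw [hA4, ← hAfin.cast_ncard_eq] at this
      exact_mod_cast this
    have hle := ncard_le_ncard hAE N.ground_finite
    rw [hE] at hle
    rcases Nat.lt_or_ge A.ncard 5 with h | h
    · right; exact ⟨hAE, by omega, hA4⟩
    rcases Nat.lt_or_ge A.ncard 6 with h' | h'
    · left; right; exact ⟨hAE, by omega⟩
    · left; left; exact ⟨hAE, by omega⟩
  have h := ncard_le_ncard hsub (((hf 6).union (hf 5)).union hS4)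
  refine h.trans ((ncard_union_le _ _).trans ?_)
  refine (Nat.add_le_add_right (ncard_union_le _ _) _).trans ?_
  rw [ncard_setOf_subset_ncard_eq N.ground_finite 6, ncard_setOf_subset_ncard_eq N.ground_finite 5, hE,
    show Nat.choose 6 6 = 1 by decide, show Nat.choose 6 5 = 6 by decide]

section RankFourOnEightUpper

variable {M : Matroid α} [M.Finite]

/-- `f(2) ≤ 28 + t + q₂ + p₅` on `8` points of rank `4`: a rank-`2` set has `2 … 5` points. -/
theorem ncard_rankSet_two_le_rank_four_eight (hM : M.eRank = ((4 : ℕ) : ℕ∞)) (hE : M.E.ncard = 8)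
    (hcol : M.coloops = ∅) :
    (rankSet M 2).ncard ≤ 28 + (rankTwoSets M 3).ncard + (rankTwoSets M 4).ncard + (rankTwoSets M 5).ncard := by
  have hf2 : {A : Set α | A ⊆ M.E ∧ A.ncard = 2}.Finite := M.ground_finite.finite_subsets.subset (fun _ hA => hA.1)
  have hsub : rankSet M 2 ⊆ {A : Set α | A ⊆ M.E ∧ A.ncard = 2} ∪ rankTwoSets M 3 ∪ rankTwoSets M 4 ∪
      rankTwoSets M 5 := by
    rintro A ⟨hAE, hA2⟩
    have hAfin : A.Finite := M.ground_finite.subset hAE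
    have hlo : 2 ≤ A.ncard := by
      have := M.eRk_le_encard A
      rw [hA2, ← hAfin.cast_ncard_eq] at this
      exact_mod_cast this
    have hmiss := sub_add_one_le_ncard_ground_sdiff_of_coloops M hM hcol hAE (k := 2) hA2 (by norm_num)
    rw [ncard_sdiff' hAE M.ground_finite, hE] at hmiss
    have hle := ncard_le_ncard hAE M.ground_finite
    rw [hE] at hle
    rcases Nat.lt_or_ge A.ncard 3 with h | h
    · left; left; left; exact ⟨hAE, by omega⟩
    rcases Nat.lt_or_ge A.ncard 4 with h' | h'
    · left; left; right; exact ⟨hAE, by omega, hA2⟩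
    rcases Nat.lt_or_ge A.ncard 5 with h'' | h''
    · left; right; exact ⟨hAE, by omega, hA2⟩
    · right; exact ⟨hAE, by omega, hA2⟩
  have h := ncard_le_ncard hsub (((hf2.union (rankTwoSets_finite M 3)).union (rankTwoSets_finite M 4)).union
    (rankTwoSets_finite M 5))
  refine h.trans ((ncard_union_le _ _).trans ?_)
  refine (Nat.add_le_add_right ((ncard_union_le _ _).trans (Nat.add_le_add_right (ncard_union_le _ _) _)) _).trans ?_
  rw [ncard_setOf_subset_ncard_eq M.ground_finite 2, hE, show Nat.choose 8 2 = 28 by decide]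

/-- `f(4) ≤ 9 + s₆ + s₅ + s₄` on `8` points of rank `4`. -/
theorem ncard_rankSet_four_le_rank_four_eight (hE : M.E.ncard = 8) :
    (rankSet M 4).ncard ≤ 9 + {Q : Set α | Q ⊆ M.E ∧ Q.ncard = 6 ∧ M.eRk Q = ((4 : ℕ) : ℕ∞)}.ncard +
      {Q : Set α | Q ⊆ M.E ∧ Q.ncard = 5 ∧ M.eRk Q = ((4 : ℕ) : ℕ∞)}.ncard +
      {Q : Set α | Q ⊆ M.E ∧ Q.ncard = 4 ∧ M.eRk Q = ((4 : ℕ) : ℕ∞)}.ncard := by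
  have hf : ∀ k : ℕ, {A : Set α | A ⊆ M.E ∧ A.ncard = k}.Finite := fun k =>
    M.ground_finite.finite_subsets.subset (fun _ hA => hA.1)
  have hS : ∀ k : ℕ, {Q : Set α | Q ⊆ M.E ∧ Q.ncard = k ∧ M.eRk Q = ((4 : ℕ) : ℕ∞)}.Finite := fun k =>
    (hf k).subset (fun _ hA => ⟨hA.1, hA.2.1⟩)
  have hsub : rankSet M 4 ⊆ {A : Set α | A ⊆ M.E ∧ A.ncard = 8} ∪ {A : Set α | A ⊆ M.E ∧ A.ncard = 7} ∪
      {Q : Set α | Q ⊆ M.E ∧ Q.ncard = 6 ∧ M.eRk Q = ((4 : ℕ) : ℕ∞)} ∪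
      {Q : Set α | Q ⊆ M.E ∧ Q.ncard = 5 ∧ M.eRk Q = ((4 : ℕ) : ℕ∞)} ∪
      {Q : Set α | Q ⊆ M.E ∧ Q.ncard = 4 ∧ M.eRk Q = ((4 : ℕ) : ℕ∞)} := by
    rintro A ⟨hAE, hA4⟩
    have hAfin : A.Finite := M.ground_finite.subset hAE
    have hlo : 4 ≤ A.ncard := by
      have := M.eRk_le_encard A
      rw [hA4, ← hAfin.cast_ncard_eq] at this
      exact_mod_cast this
    have hle := ncard_le_ncard hAE M.ground_finite
    rw [hE] at hle
    rcases Nat.lt_or_ge A.ncard 5 with h | h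
    · right; exact ⟨hAE, by omega, hA4⟩
    rcases Nat.lt_or_ge A.ncard 6 with h' | h'
    · left; right; exact ⟨hAE, by omega, hA4⟩
    rcases Nat.lt_or_ge A.ncard 7 with h'' | h''
    · left; left; right; exact ⟨hAE, by omega, hA4⟩
    rcases Nat.lt_or_ge A.ncard 8 with h''' | h'''
    · left; left; left; right; exact ⟨hAE, by omega⟩
    · left; left; left; left; exact ⟨hAE, by omega⟩
  have h := ncard_le_ncard hsub (((((hf 8).union (hf 7)).union (hS 6)).union (hS 5)).union (hS 4))
  refine h.trans ((ncard_union_le _ _).trans ?_)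
  refine (Nat.add_le_add_right ((ncard_union_le _ _).trans (Nat.add_le_add_right ((ncard_union_le _ _).trans
    (Nat.add_le_add_right (ncard_union_le _ _) _)) _)) _).trans ?_
  rw [ncard_setOf_subset_ncard_eq M.ground_finite 8, ncard_setOf_subset_ncard_eq M.ground_finite 7, hE,
    show Nat.choose 8 8 = 1 by decide, show Nat.choose 8 7 = 8 by decide]

/-- `q₂ + q₃ + s₄ ≤ 70`: three disjoint families of `4`-sets. -/
theorem four_sets_le_seventy_rank_four_eight (hE : M.E.ncard = 8) :
    (rankTwoSets M 4).ncard + {Q : Set α | Q ⊆ M.E ∧ Q.ncard = 4 ∧ M.eRk Q = ((3 : ℕ) : ℕ∞)}.ncard +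
      {Q : Set α | Q ⊆ M.E ∧ Q.ncard = 4 ∧ M.eRk Q = ((4 : ℕ) : ℕ∞)}.ncard ≤ 70 := by
  have hf4 : {A : Set α | A ⊆ M.E ∧ A.ncard = 4}.Finite := M.ground_finite.finite_subsets.subset (fun _ hA => hA.1)
  have hQ3 : {Q : Set α | Q ⊆ M.E ∧ Q.ncard = 4 ∧ M.eRk Q = ((3 : ℕ) : ℕ∞)}.Finite :=
    hf4.subset (fun _ hA => ⟨hA.1, hA.2.1⟩)
  have hS4 : {Q : Set α | Q ⊆ M.E ∧ Q.ncard = 4 ∧ M.eRk Q = ((4 : ℕ) : ℕ∞)}.Finite :=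
    hf4.subset (fun _ hA => ⟨hA.1, hA.2.1⟩)
  have hsub : rankTwoSets M 4 ∪ {Q : Set α | Q ⊆ M.E ∧ Q.ncard = 4 ∧ M.eRk Q = ((3 : ℕ) : ℕ∞)} ∪
      {Q : Set α | Q ⊆ M.E ∧ Q.ncard = 4 ∧ M.eRk Q = ((4 : ℕ) : ℕ∞)} ⊆ {A : Set α | A ⊆ M.E ∧ A.ncard = 4} := by
    rintro A ((⟨hAE, h4, -⟩ | ⟨hAE, h4, -⟩) | ⟨hAE, h4, -⟩) <;> exact ⟨hAE, h4⟩
  have h := ncard_le_ncard hsub hf4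
  rwa [ncard_union_eq (by
        rw [Set.disjoint_left]
        rintro A (⟨-, -, h2⟩ | ⟨-, -, h3⟩) ⟨-, -, h4⟩
        · rw [h4] at h2; exact absurd h2 (by decide)
        · rw [h4] at h3; exact absurd h3 (by decide)) ((rankTwoSets_finite M 4).union hQ3) hS4,
    ncard_union_eq (by
        rw [Set.disjoint_left]
        rintro A ⟨-, -, h2⟩ ⟨-, -, h3⟩
        rw [h3] at h2; exact absurd h2 (by decide)) (rankTwoSets_finite M 4) hQ3,
    ncard_setOf_subset_ncard_eq M.ground_finite 4, hE, show Nat.choose 8 4 = 70 by decide] at h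

end RankFourOnEightUpper

/-- The nine slices of two parts against `S₁ S₂ − f₁(2) f₂(2) − f₁(4) f₂(4) + f₁(1) f₂(4) + f₁(4) f₂(1)`. -/
theorem y_products_general {a1 a2 a3 a4 b1 b2 b3 b4 c1 c2 d1 d2 : ℕ} (h1 : c1 ≤ a1) (h2 : c2 ≤ b1)
    (hA : d1 ≤ a2 + a3 + a4) (hB : d2 ≤ b2 + b3 + b4) :
    d1 * d2 + c1 * b4 + c2 * a4 ≤ a1 * b4 + a2 * b3 + a2 * b4 + a3 * b2 + a3 * b3 + a3 * b4 + a4 * b1 + a4 * b2 +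
      a4 * b3 + a2 * b2 + a4 * b4 := by
  have e1 := Nat.mul_le_mul_right b4 h1
  have e2 := Nat.mul_le_mul_left a4 h2
  have e3 : d1 * d2 ≤ (a2 + a3 + a4) * (b2 + b3 + b4) := Nat.mul_le_mul hA hB
  have expand : (a2 + a3 + a4) * (b2 + b3 + b4) =
      a2 * b2 + a2 * b3 + a2 * b4 + a3 * b2 + a3 * b3 + a3 * b4 + a4 * b2 + a4 * b3 + a4 * b4 := by ring
  rw [expand] at e3
  linarith [e1, e2, e3]

/-- The arithmetic of `(rank 4 on 6) ⊕ (rank 4 on 8)` at `(8, 4)`. -/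
theorem consumer_arith_four_six_four_eight {u y t q2 q3 s4 s5 s6 s41 F12 F22 F14 F24 : ℚ}
    (hU : u ≤ s4 + 6 * (s5 + q3) + s41 * (s6 + t + q2))
    (hY : 14079 + 6 * F24 + 8 * F14 ≤ y + F12 * F22 + F14 * F24)
    (hF12 : F12 ≤ 30) (hF22 : F22 ≤ 72) (hF14 : F14 ≤ 7 + s41) (hF24 : F24 ≤ 9 + s6 + s5 + s4)
    (hs41 : s41 ≤ 15) (h70 : q2 + q3 + s4 ≤ 70) (hs5 : s5 ≤ 56) (hs6 : s6 ≤ 28) (ht : t ≤ 28) (hq2 : q2 ≤ 14)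
    (ht' : 0 ≤ t) (hq2' : 0 ≤ q2) (hs4' : 0 ≤ s4) (hs5' : 0 ≤ s5) (hs6' : 0 ≤ s6) (hs41' : 0 ≤ s41)
    (hF22' : 0 ≤ F22) (hF14' : 0 ≤ F14) (hF24' : 0 ≤ F24) : 76 / 15 * u ≤ y := by
  nlinarith [mul_le_mul hF12 hF22 hF22' (by norm_num), mul_le_mul hF14 hF24 hF24' (by linarith),
    mul_nonneg hs41' hs6', mul_nonneg hs41' ht', mul_nonneg hs41' hq2',
    mul_nonneg (sub_nonneg.mpr hs41) hs6', mul_nonneg (sub_nonneg.mpr hs41) ht', mul_nonneg (sub_nonneg.mpr hs41) hq2',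
    mul_nonneg (sub_nonneg.mpr hs41) hs5', mul_nonneg (sub_nonneg.mpr hs41) hs4',
    mul_nonneg hs41' hs5', mul_nonneg hs41' hs4']

/-- **`M ⊕ N` at `(8, 4)`**: `M` coloop-free of rank `4` on `6` points, `N` coloop-free of rank `4` on `8` points,
both with all pairs of rank `2`. -/
theorem c025_eight_four_disjointSum_four_six_four_eight (M N : Matroid α) [M.Finite] [N.Finite]
    (h : Disjoint M.E N.E) (hM : M.eRank = ((4 : ℕ) : ℕ∞)) (hME : M.E.ncard = 6) (hcolM : M.coloops = ∅)
    (hpairsM : ∀ e ∈ M.E, ∀ f ∈ M.E, e ≠ f → M.eRk {e, f} = 2) (hN : N.eRank = ((4 : ℕ) : ℕ∞))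
    (hNE : N.E.ncard = 8) (hcolN : N.coloops = ∅) (hpairsN : ∀ e ∈ N.E, ∀ f ∈ N.E, e ≠ f → N.eRk {e, f} = 2) :
    phiK 8 4 * ({A : Set α | A ⊆ (M.disjointSum N h).E ∧ (M.disjointSum N h).eRk A = ((8 : ℕ) : ℕ∞) ∧
        (M.disjointSum N h).eRk ((M.disjointSum N h).E \ A) = ((4 : ℕ) : ℕ∞)}.ncard : ℚ) ≤
      ({A : Set α | A ⊆ (M.disjointSum N h).E ∧ ((4 : ℕ) : ℕ∞) < (M.disjointSum N h).eRk A ∧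
        (M.disjointSum N h).eRk A < ((8 : ℕ) : ℕ∞)}.ncard : ℚ) := by
  have hSfin : {A : Set α | A ⊆ M.E ∧ A.ncard = 4 ∧ M.eRk A = ((4 : ℕ) : ℕ∞)}.Finite :=
    M.ground_finite.finite_subsets.subset (fun _ hA => hA.1)
  -- the `N`-side complements
  have hN44 := ncard_profileSet_four_four_le_rank_four_eight (M := N) hNE
  have hN43 := ncard_profileSet_four_three_le_rank_four_eight (M := N) hNE
  have hN42 := ncard_profileSet_four_two_le_rank_four_eight hN hNE hcolN
  -- the `U`-side: the slices `(0, 4)`, `(1, 3)`, `(2, 2)` (first index: `M`'s complement rank)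
  have hU : {A : Set α | A ⊆ (M.disjointSum N h).E ∧ (M.disjointSum N h).eRk A = ((8 : ℕ) : ℕ∞) ∧
      (M.disjointSum N h).eRk ((M.disjointSum N h).E \ A) = ((4 : ℕ) : ℕ∞)}.ncard ≤
      {Q : Set α | Q ⊆ N.E ∧ Q.ncard = 4 ∧ N.eRk Q = ((4 : ℕ) : ℕ∞)}.ncard +
        6 * ({Q : Set α | Q ⊆ N.E ∧ Q.ncard = 5 ∧ N.eRk Q = ((4 : ℕ) : ℕ∞)}.ncard +
          {Q : Set α | Q ⊆ N.E ∧ Q.ncard = 4 ∧ N.eRk Q = ((3 : ℕ) : ℕ∞)}.ncard) +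
        {A : Set α | A ⊆ M.E ∧ A.ncard = 4 ∧ M.eRk A = ((4 : ℕ) : ℕ∞)}.ncard *
          ({Q : Set α | Q ⊆ N.E ∧ Q.ncard = 6 ∧ N.eRk Q = ((4 : ℕ) : ℕ∞)}.ncard + (rankTwoSets N 3).ncard +
            (rankTwoSets N 4).ncard) := by
    rw [disjointSum_ncard_U_eq_finsum M N h 8 4, finsum_mem_coe_finset]
    have hsub : ({(4, 0), (4, 1), (4, 2)} : Finset (ℕ × ℕ)) ⊆ Finset.range (8 + 1) ×ˢ Finset.range (4 + 1) := by
      decide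
    rw [← Finset.sum_subset hsub ?_]
    · rw [Finset.sum_insert (by decide), Finset.sum_insert (by decide), Finset.sum_singleton]
      dsimp only
      show (profileSet M 4 0).ncard * (profileSet N 4 4).ncard + ((profileSet M 4 1).ncard * (profileSet N 4 3).ncard +
        (profileSet M 4 2).ncard * (profileSet N 4 2).ncard) ≤ _
      have hM40 := ncard_profileSet_top_zero_le_of_pairs M hpairsM (by omega) 4
      have hM41 := ncard_profileSet_top_one_le_of_pairs' hpairsM 4
      rw [hME] at hM41
      have hM42 := ncard_le_ncard (profileSet_four_two_subset_spanning_four hME) hSfin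
      have e1 := Nat.mul_le_mul hM40 hN44
      have e2 := Nat.mul_le_mul hM41 hN43
      have e3 := Nat.mul_le_mul hM42 hN42
      linarith [e1, e2, e3]
    · rintro ⟨a, b⟩ hmem hnot
      rw [Finset.mem_product, Finset.mem_range, Finset.mem_range] at hmem
      simp only [Finset.mem_insert, Finset.mem_singleton, Prod.mk.injEq, not_or] at hnot
      dsimp only
      rcases Nat.lt_or_ge 4 a with ha | ha
      · rw [profileSet_eq_empty_of_eRank_lt M hM ha b, ncard_empty, zero_mul]
      rcases Nat.lt_or_ge a 4 with ha' | ha'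
      · have h8a : 4 < 8 - a := by omega
        rw [profileSet_eq_empty_of_eRank_lt N hN h8a (4 - b), ncard_empty, mul_zero]
      have ha4 : a = 4 := by omega
      subst ha4
      rw [show (8 : ℕ) - 4 = 4 from rfl]
      have hb : 2 < b := by omega
      -- `N_M(4, b) = ∅` for `b ≥ 3` on `6` points
      have h6 : M.E.ncard < 4 + b := by rw [hME]; omega
      rw [profileSet_eq_empty_of_ncard_lt M h6, ncard_empty, zero_mul]
  -- the `Y`-side: the nine slices
  have hY : 57 * 247 + 6 * (rankSet N 4).ncard + 8 * (rankSet M 4).ncard ≤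
      {A : Set α | A ⊆ (M.disjointSum N h).E ∧ ((4 : ℕ) : ℕ∞) < (M.disjointSum N h).eRk A ∧
        (M.disjointSum N h).eRk A < ((8 : ℕ) : ℕ∞)}.ncard + (rankSet M 2).ncard * (rankSet N 2).ncard +
        (rankSet M 4).ncard * (rankSet N 4).ncard := by
    rw [disjointSum_ncard_Y_eq_finsum M N h 8 4, finsum_mem_coe_finset]
    have hsub : ({(1, 4), (2, 3), (2, 4), (3, 2), (3, 3), (3, 4), (4, 1), (4, 2), (4, 3)} : Finset (ℕ × ℕ)) ⊆
        (Finset.range 8 ×ˢ Finset.range 8).filter (fun x : ℕ × ℕ => 4 < x.1 + x.2 ∧ x.1 + x.2 < 8) := by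
      decide
    have hle := Finset.sum_le_sum_of_subset hsub
      (f := fun x : ℕ × ℕ => (rankSet M x.1).ncard * (rankSet N x.2).ncard)
    rw [Finset.sum_insert (by decide), Finset.sum_insert (by decide), Finset.sum_insert (by decide),
      Finset.sum_insert (by decide), Finset.sum_insert (by decide), Finset.sum_insert (by decide),
      Finset.sum_insert (by decide), Finset.sum_insert (by decide), Finset.sum_singleton] at hle
    dsimp only at hle
    have F1 : 6 ≤ (rankSet M 1).ncard := by
      have := ncard_le_ncard_rankSet_one_of_pairs hpairsM (by omega)
      rwa [hME] at this
    have G1 : 8 ≤ (rankSet N 1).ncard := by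
      have := ncard_le_ncard_rankSet_one_of_pairs hpairsN (by omega)
      rwa [hNE] at this
    have hA := ncard_rankSet_two_three_four_ge_of_pairs M hM hpairsM
    rw [hME, show 2 ^ 6 - 1 - 6 = 57 by decide] at hA
    have hB := ncard_rankSet_two_three_four_ge_of_pairs N hN hpairsN
    rw [hNE, show 2 ^ 8 - 1 - 8 = 247 by decide] at hB
    have hp := y_products_general F1 G1 hA hB
    linarith [hle, hp]
  -- the upper bounds
  have hF12 : (rankSet M 2).ncard ≤ 30 := by
    have hcl : ∀ x ∈ M.E, ∀ y ∈ M.E, x ≠ y → (M.closure {x, y}).ncard ≤ 4 := by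
      intro x hx y hy hxy
      have := ncard_closure_pair_le_of_coloops' M hM (by norm_num) hcolM hpairsM hx hy hxy
      rw [hME] at this
      omega
    have hbig := ncard_bigRankTwo_le_choose M hpairsM hcl
    have h2 := ncard_rankSet_two_le_add_big M
    rw [hME, show Nat.choose 6 2 = 15 by decide] at hbig h2
    omega
  have hF14 := ncard_rankSet_four_le_rank_four_six (N := M) hME
  have hF22raw := ncard_rankSet_two_le_rank_four_eight hN hNE hcolN
  have hcl : ∀ x ∈ N.E, ∀ y ∈ N.E, x ≠ y → (N.closure {x, y}).ncard ≤ 3 + 2 := by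
    intro x hx y hy hxy
    have := ncard_closure_pair_le_of_coloops' N hN (by norm_num) hcolN hpairsN hx hy hxy
    rw [hNE] at this
    omega
  have ht := choose_mul_ncard_rankTwoSets_le N hpairsN (c := 3) (m := 3) hcl
  have hq2 := choose_mul_ncard_rankTwoSets_le N hpairsN (c := 3) (m := 4) hcl
  have hp5 := choose_mul_ncard_rankTwoSets_le N hpairsN (c := 3) (m := 5) hcl
  rw [hNE, show Nat.choose 3 2 = 3 by decide, show Nat.choose 3 (3 - 2) = 3 by decide,
    show Nat.choose 8 2 = 28 by decide] at ht
  rw [hNE, show Nat.choose 4 2 = 6 by decide, show Nat.choose 3 (4 - 2) = 3 by decide,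
    show Nat.choose 8 2 = 28 by decide] at hq2
  rw [hNE, show Nat.choose 5 2 = 10 by decide, show Nat.choose 3 (5 - 2) = 1 by decide,
    show Nat.choose 8 2 = 28 by decide] at hp5
  have hF22 : (rankSet N 2).ncard ≤ 72 := by omega
  have hF24 := ncard_rankSet_four_le_rank_four_eight (M := N) hNE
  have h70 := four_sets_le_seventy_rank_four_eight (M := N) hNE
  have hs5 : {Q : Set α | Q ⊆ N.E ∧ Q.ncard = 5 ∧ N.eRk Q = ((4 : ℕ) : ℕ∞)}.ncard ≤ 56 := by
    have hf5 : {A : Set α | A ⊆ N.E ∧ A.ncard = 5}.Finite := N.ground_finite.finite_subsets.subset (fun _ hA => hA.1)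
    have := ncard_le_ncard (show {Q : Set α | Q ⊆ N.E ∧ Q.ncard = 5 ∧ N.eRk Q = ((4 : ℕ) : ℕ∞)} ⊆
      {A : Set α | A ⊆ N.E ∧ A.ncard = 5} from fun A hA => ⟨hA.1, hA.2.1⟩) hf5
    rwa [ncard_setOf_subset_ncard_eq N.ground_finite 5, hNE, show Nat.choose 8 5 = 56 by decide] at this
  have hs6 : {Q : Set α | Q ⊆ N.E ∧ Q.ncard = 6 ∧ N.eRk Q = ((4 : ℕ) : ℕ∞)}.ncard ≤ 28 := by
    have hf6 : {A : Set α | A ⊆ N.E ∧ A.ncard = 6}.Finite := N.ground_finite.finite_subsets.subset (fun _ hA => hA.1)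
    have := ncard_le_ncard (show {Q : Set α | Q ⊆ N.E ∧ Q.ncard = 6 ∧ N.eRk Q = ((4 : ℕ) : ℕ∞)} ⊆
      {A : Set α | A ⊆ N.E ∧ A.ncard = 6} from fun A hA => ⟨hA.1, hA.2.1⟩) hf6
    rwa [ncard_setOf_subset_ncard_eq N.ground_finite 6, hNE, show Nat.choose 8 6 = 28 by decide] at this
  have hs41 : {A : Set α | A ⊆ M.E ∧ A.ncard = 4 ∧ M.eRk A = ((4 : ℕ) : ℕ∞)}.ncard ≤ 15 := by
    have hf4 : {A : Set α | A ⊆ M.E ∧ A.ncard = 4}.Finite := M.ground_finite.finite_subsets.subset (fun _ hA => hA.1)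
    have := ncard_le_ncard (show {A : Set α | A ⊆ M.E ∧ A.ncard = 4 ∧ M.eRk A = ((4 : ℕ) : ℕ∞)} ⊆
      {A : Set α | A ⊆ M.E ∧ A.ncard = 4} from fun A hA => ⟨hA.1, hA.2.1⟩) hf4
    rwa [ncard_setOf_subset_ncard_eq M.ground_finite 4, hME, show Nat.choose 6 4 = 15 by decide] at this
  rw [phiK_eight_four]
  -- name the quantities, then cast once
  generalize hu0 : {A : Set α | A ⊆ (M.disjointSum N h).E ∧ (M.disjointSum N h).eRk A = ((8 : ℕ) : ℕ∞) ∧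
      (M.disjointSum N h).eRk ((M.disjointSum N h).E \ A) = ((4 : ℕ) : ℕ∞)}.ncard = u at hU ⊢
  generalize hy0 : {A : Set α | A ⊆ (M.disjointSum N h).E ∧ ((4 : ℕ) : ℕ∞) < (M.disjointSum N h).eRk A ∧
      (M.disjointSum N h).eRk A < ((8 : ℕ) : ℕ∞)}.ncard = y at hY ⊢
  generalize ht0 : (rankTwoSets N 3).ncard = t at *
  generalize hq20 : (rankTwoSets N 4).ncard = q2 at *
  generalize hq30 : {Q : Set α | Q ⊆ N.E ∧ Q.ncard = 4 ∧ N.eRk Q = ((3 : ℕ) : ℕ∞)}.ncard = q3 at *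
  generalize hs40 : {Q : Set α | Q ⊆ N.E ∧ Q.ncard = 4 ∧ N.eRk Q = ((4 : ℕ) : ℕ∞)}.ncard = s4 at *
  generalize hs50 : {Q : Set α | Q ⊆ N.E ∧ Q.ncard = 5 ∧ N.eRk Q = ((4 : ℕ) : ℕ∞)}.ncard = s5 at *
  generalize hs60 : {Q : Set α | Q ⊆ N.E ∧ Q.ncard = 6 ∧ N.eRk Q = ((4 : ℕ) : ℕ∞)}.ncard = s6 at *
  generalize hs410 : {A : Set α | A ⊆ M.E ∧ A.ncard = 4 ∧ M.eRk A = ((4 : ℕ) : ℕ∞)}.ncard = s41 at *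
  generalize hf120 : (rankSet M 2).ncard = f12 at *
  generalize hf220 : (rankSet N 2).ncard = f22 at *
  generalize hf140 : (rankSet M 4).ncard = f14 at *
  generalize hf240 : (rankSet N 4).ncard = f24 at *
  have hU' : (u : ℚ) ≤ s4 + 6 * ((s5 : ℚ) + q3) + (s41 : ℚ) * ((s6 : ℚ) + t + q2) := by exact_mod_cast hU
  have hY' : (14079 : ℚ) + 6 * f24 + 8 * f14 ≤ (y : ℚ) + (f12 : ℚ) * f22 + (f14 : ℚ) * f24 := by
    have : 14079 + 6 * f24 + 8 * f14 ≤ y + f12 * f22 + f14 * f24 := by linarith [hY]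
    exact_mod_cast this
  have hF12' : (f12 : ℚ) ≤ 30 := by exact_mod_cast hF12
  have hF22' : (f22 : ℚ) ≤ 72 := by exact_mod_cast hF22
  have hF14' : (f14 : ℚ) ≤ 7 + s41 := by exact_mod_cast hF14
  have hF24' : (f24 : ℚ) ≤ 9 + s6 + s5 + s4 := by exact_mod_cast hF24
  have hs41' : (s41 : ℚ) ≤ 15 := by exact_mod_cast hs41
  have h70' : (q2 : ℚ) + q3 + s4 ≤ 70 := by exact_mod_cast h70
  have hs5' : (s5 : ℚ) ≤ 56 := by exact_mod_cast hs5
  have hs6' : (s6 : ℚ) ≤ 28 := by exact_mod_cast hs6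
  have ht' : (t : ℚ) ≤ 28 := by
    have : t ≤ 28 := by omega
    exact_mod_cast this
  have hq2' : (q2 : ℚ) ≤ 14 := by
    have : q2 ≤ 14 := by omega
    exact_mod_cast this
  exact consumer_arith_four_six_four_eight (u := (u : ℚ)) (y := (y : ℚ)) (t := (t : ℚ)) (q2 := (q2 : ℚ))
    (q3 := (q3 : ℚ)) (s4 := (s4 : ℚ)) (s5 := (s5 : ℚ)) (s6 := (s6 : ℚ)) (s41 := (s41 : ℚ)) (F12 := (f12 : ℚ))
    (F22 := (f22 : ℚ)) (F14 := (f14 : ℚ)) (F24 := (f24 : ℚ)) hU' hY' hF12' hF22' hF14' hF24' hs41' h70' hs5' hs6'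
    ht' hq2' (Nat.cast_nonneg t) (Nat.cast_nonneg q2) (Nat.cast_nonneg s4) (Nat.cast_nonneg s5)
    (Nat.cast_nonneg s6) (Nat.cast_nonneg s41) (Nat.cast_nonneg f22) (Nat.cast_nonneg f14)
    (Nat.cast_nonneg f24)

end S1

end PercRepro
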